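import Literature.Probability.LatticeModels.TorusDiscretePolya
import Literature.Analysis.Matrix.HankelBlockLogConvex
import HarnessLib

/-!
# Axis infinite divisibility of 2-block kernels from odd-shift Hankel positivity + one local input

Abstract assembly of the "AxisInfDiv" chain (crux `Block2InfDivXXZ`, route `LevyLogBootstrap`, summit
HubbardSuperconductivity; prover analysis 2026-08-17): let `F : ℕ → ℝ` be a (row-summed) two-point
function of the separation on a cycle of even length `2m`, symmetric (`F(j) = F(2m - j)`), whose
odd-shift Hankel form `∑ c_i c_j F(i+j+1)` on `ℝ^m` is positive semidefinite — the output of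
bond-plane reflection positivity. Let `g` be the 2-BLOCK kernel along the coarse cycle `ℤ/mℤ`:
`g(X) = F(2n-1) + 2F(2n) + F(2n+1)` for `X = n ≠ 0` (`twoBlockSum F (2n)`), `g(0) > 0` arbitrary
(it contains the contact term), `g` even and positive. Then
(`isNegDefKernel_negLog_twoBlock_of_hankelOddForm`): IF the single local inequality
`g(1)² ≤ g(0) · g(2)` holds, the kernel `(a, b) ↦ -log g(a - b)` on `ℤ/mℤ` is negative definite,
i.e. `g(a - b)` is infinitely divisible (Schoenberg). Ingredients: log-convexity of `g` at every
centre `n ≥ 2` from the Hankel hypothesis (`hankelBlock_logConvex`), the local input at `n = 1`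
(and `n = m - 1` by evenness), and the discrete Pólya criterion on the cycle with Bochner in
negative-type form (`isNegDefKernel_negLog_sub_of_logConvex`). The `n = 1` inequality is NOT a
consequence of reflection positivity (it fails for short-range kernels with correlation length
`< 1/log 2`); it is the honest residual input of axis infinite divisibility. [folklore] throughout.
-/

noncomputable section

open Finset
open scoped BigOperators
open Literature.Analysis.Matrix

namespace Literature.Probability.LatticeModels

variable {m : ℕ} [NeZero m]

omit [NeZero m] in
/-- Sites of the one-dimensional torus are determined by their single coordinate. [folklore] -/
theorem TorusSite.eq_of_apply_zero {X Y : TorusSite 1 m} (h : X 0 = Y 0) : X = Y := by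
  funext i
  rw [Subsingleton.elim i 0]
  exact h

/-- A site of the cycle is the cast of its representative: `X = (X 0).val • 1`-free form,
`X 0 = ((X 0).val : ZMod m)`. [folklore] -/
theorem TorusSite.apply_zero_eq_natCast_val (X : TorusSite 1 m) :
    X 0 = (((X 0).val : ℕ) : ZMod m) := (ZMod.natCast_zmod_val (X 0)).symm

/-- **Axis infinite divisibility of a 2-block kernel from odd-shift Hankel positivity and the local
`n = 1` inequality.** See the module docstring. Hypotheses: `g > 0` and even on `ℤ/mℤ`;
`g(X) = twoBlockSum F (2·X.val)` for `X ≠ 0`; the odd-shift Hankel form of `F` on `ℝ^m` is positive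
semidefinite; and `g(1)² ≤ g(0) g(2)`. Conclusion: `-log g(a - b)` is a negative definite kernel.
[folklore] -/
theorem isNegDefKernel_negLog_twoBlock_of_hankelOddForm (F : ℕ → ℝ) (g : TorusSite 1 m → ℝ)
    (hgpos : ∀ X, 0 < g X) (hgeven : ∀ X, g (-X) = g X)
    (hg : ∀ X : TorusSite 1 m, X ≠ 0 → g X = twoBlockSum F (2 * (X 0).val))
    (hpsd : ∀ c : Fin m → ℝ, 0 ≤ hankelOddForm F m c c)
    (h1 : g (fun _ => 1) ^ 2 ≤ g 0 * g ((fun _ => 1) + fun _ => 1)) :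
    IsNegDefKernel fun a b : TorusSite 1 m => -Real.log (g (a - b)) := by
  set u : TorusSite 1 m := fun _ => 1 with hu
  refine isNegDefKernel_negLog_sub_of_logConvex g hgpos hgeven fun X hX => ?_
  show g X ^ 2 ≤ g (X + u) * g (X - u)
  by_cases hXu : X = u
  · -- the local input at `n = 1`
    rw [hXu, sub_self, mul_comm (g (u + u)) (g 0)]
    exact h1
  by_cases hXnu : X = -u
  · -- `n = m - 1`, by evenness the same inequality
    rw [hXnu, neg_add_cancel, ← hgeven (-u - u), neg_sub, sub_neg_eq_add, hgeven u]
    exact h1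
  -- generic case: `X = n` with `2 ≤ n ≤ m - 2`; Hankel log-convexity
  set n : ℕ := (X 0).val with hn
  have hnlt : n < m := ZMod.val_lt (X 0)
  have hX0 : X 0 = ((n : ℕ) : ZMod m) := TorusSite.apply_zero_eq_natCast_val X
  have hn0 : n ≠ 0 := by
    intro h0
    apply hX
    refine TorusSite.eq_of_apply_zero ?_
    rw [hX0, h0, Nat.cast_zero]
    rfl
  have hn1 : n ≠ 1 := by
    intro h1'
    apply hXu
    refine TorusSite.eq_of_apply_zero ?_
    rw [hX0, h1', Nat.cast_one]
  have hnm1 : n ≠ m - 1 := by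
    intro h'
    apply hXnu
    refine TorusSite.eq_of_apply_zero ?_
    rw [hX0, h']
    show ((m - 1 : ℕ) : ZMod m) = -(1 : ZMod m)
    rw [Nat.cast_sub (Nat.one_le_iff_ne_zero.2 (NeZero.ne m)), Nat.cast_one, ZMod.natCast_self,
      zero_sub]
  have h2n : 2 ≤ n := by omega
  have hn2m : n + 2 ≤ m := by omega
  -- values of the neighbours
  have hXp : (X + u) 0 = (((n + 1 : ℕ)) : ZMod m) := by
    show X 0 + 1 = _
    rw [hX0]; push_cast; ring
  have hXm : (X - u) 0 = (((n - 1 : ℕ)) : ZMod m) := by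
    show X 0 - 1 = _
    rw [hX0, Nat.cast_sub (by omega : 1 ≤ n), Nat.cast_one]
  have hvalp : ((X + u) 0).val = n + 1 := by
    rw [hXp, ZMod.val_natCast, Nat.mod_eq_of_lt (by omega)]
  have hvalm : ((X - u) 0).val = n - 1 := by
    rw [hXm, ZMod.val_natCast, Nat.mod_eq_of_lt (by omega)]
  have hXp0 : X + u ≠ 0 := by
    intro h
    have := congrArg (fun Y : TorusSite 1 m => (Y 0).val) h
    simp only [hvalp, Pi.zero_apply, ZMod.val_zero] at this
    omega
  have hXm0 : X - u ≠ 0 := by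
    intro h
    have := congrArg (fun Y : TorusSite 1 m => (Y 0).val) h
    simp only [hvalm, Pi.zero_apply, ZMod.val_zero] at this
    omega
  rw [hg X hX, hg (X + u) hXp0, hg (X - u) hXm0, hvalp, hvalm, ← hn]
  have hlc := hankelBlock_logConvex F m hpsd n h2n hn2m
  have e1 : 2 * n - 2 = 2 * (n - 1) := by omega
  have e2 : 2 * n + 2 = 2 * (n + 1) := by omega
  rw [e1, e2] at hlc
  linarith [hlc]

end Literature.Probability.LatticeModels

end
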